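import Literature.AnabelianGeometry.AbsoluteAnabelian.DiagramsOfCategories

/-!
# Telecores: the restriction condition `𝒥|_𝒮 = ℋ` is well-posed ([AbsTopIII] Def. 3.5 (iv))

S. Mochizuki, *Topics in Absolute Anabelian Geometry III*, Def. 3.5 (iv) p. 76 (manuscript
`paper:url-5493eb38cbb7`, bib key `MochizukiAbsTopIII2015`): a telecore `𝒯` over a core `𝒮` carries
a family of homotopies `𝒥` on `𝒯` "such that `𝒥|_𝒮 = ℋ`".  In `DiagramsOfCategories.lean` (seat
abc-iut-L4-t2) the graph `Γ⃗_𝒯` is the observable's graph with telecore edges added, and the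
restriction is phrased along the inclusion prefunctor `telecoreInclusion`; the structure `Telecore`
asks its constructor for the compatibility `pathFunctor_incl` of the path functors of the two
extended diagrams along that inclusion.  This file PROVES that compatibility once and for all
(it holds by construction of `extend` / `telecoreInclusion`; advisory of the review of p404096),
so that telecore constructions — e.g. for [AbsTopIII] Cor. 3.6 (ii) / 3.7 (ii) / 4.5 (ii) — can
cite it.  Pure category-theoretic bookkeeping; no claim of the paper is asserted.
-/

namespace Literature.AnabelianGeometry.AbsoluteAnabelian

open _root_.CategoryTheory _root_.Quiver

universe v u w

namespace DiagramOfCategories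

variable {V : Type w} [Quiver.{v} V] (D : DiagramOfCategories.{v, u, w} V)

/-- **`𝒥|_𝒮 = ℋ` is well-posed**: along the inclusion `Γ⃗_𝒮 ↪ Γ⃗_𝒯` of an observable's graph into the
graph with telecore edges added, the path functors of the two extended diagrams agree (Def. 3.5
(iv) (b); this is the `pathFunctor_incl` field of `Telecore`, here PROVED for every observable, every
family of telecore edges and every choice of functors on them).
[cite: MochizukiAbsTopIII2015, Definition 3.5 (iv) p.76] -/
theorem pathFunctor_telecoreInclusion (S : D.Observable) (J : V → Type v)
    (telMap : ∀ {a : V}, J a → (S.ext.S ⥤ D.obj a)) :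
    ∀ {a b : S.shape.Vertex} (p : Path a b),
      HEq ((D.extend S.ext).pathFunctor p)
        ((D.extend (X := ⟨S.shape.I, J⟩) ⟨S.ext.S, S.ext.obsMap, telMap⟩).pathFunctor
          ((telecoreInclusion S.shape S.isEmpty_J J).mapPath p)) := by
  intro a b p
  induction p with
  | nil =>
    rw [Prefunctor.mapPath_nil, pathFunctor_nil, pathFunctor_nil]
    cases a <;> rfl
  | cons p e ih =>
    rename_i c b
    rw [Prefunctor.mapPath_cons, pathFunctor_cons, pathFunctor_cons]
    revert ih
    cases a <;> cases c <;> cases b <;>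
      first
        | exact (PEmpty.elim e)
        | exact ((S.isEmpty_J _).false e).elim
        | (intro ih; rw [eq_of_heq ih]; rfl)

end DiagramOfCategories

end Literature.AnabelianGeometry.AbsoluteAnabelian
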